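import Summits.Ventures.YMGap.RobustBall.ParallelPairCode
import HarnessLib

/-!
# RobustBall/ParallelPairFine — the MARKED polymer of a parallel plaquette pair and what it determines
(cell `pub-ymgap`, track Y2 ROBUST-BALL, T0.2 witness (w3), reads-incidence upgrade; p1)

HONEST FRAMING: finite-torus combinatorics only (no probability, no continuum, no Clay claim).

For the reads-incidence (`FineBall`) version of the parallel-pair witness the polymer must DETERMINE the links of its
terms. The plain pair code `{x, x+e_i, x+e_j, x+e_k, x+e_k+e_i, x+e_k+e_j}` does (for `L ≥ 3`), but only through
neighbour-counting; adding the MARKER `x − e_k` makes `k` the unique direction with three coordinate values, after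
which `x` and the unordered pair `{i, j}` are read off coordinate projections exactly as for rectangles
(`RobustBall/RectangleCode`). We prove: coordinates of the marked code, periodic sup-diameter `≤ 2`, and
`pairCodeM_decode` (`3 ≤ L`): equal marked codes have the same `x`, the same `k` and the same `{i, j}`.
-/

noncomputable section

open Finset Function
open Literature.MathematicalPhysics.QuantumLattice hiding torusNorm
open Literature.MathematicalPhysics.QuantumFieldTheory hiding ZdEdge

namespace Summit.Ventures.YMGap.RobustBall

variable {d L : ℕ}

/-- The MARKED polymer of the parallel pair `(x; i, j)`, `(x+e_k; i, j)`: the pair code plus the marker `x − e_k`.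
[folklore] -/
def pairCodeM (x : Site d L) (i j k : Fin d) : Finset (Site d L) :=
  insert (x - unitVec k) (pairCode x i j k)

/-- The pair code is contained in the marked code. [folklore] -/
theorem pairCode_subset_pairCodeM (x : Site d L) (i j k : Fin d) : pairCode x i j k ⊆ pairCodeM x i j k :=
  subset_insert _ _

section Coordinates

variable {x : Site d L} {i j k : Fin d}

/-- Off `i, j, k` every marked-code point agrees with `x`. [folklore] -/
theorem apply_eq_of_mem_pairCodeM {p : Site d L} (hp : p ∈ pairCodeM x i j k) {v : Fin d} (hvi : v ≠ i) (hvj : v ≠ j)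
    (hvk : v ≠ k) : p v = x v := by
  simp only [pairCodeM, pairCode, mem_insert, mem_singleton] at hp
  rcases hp with rfl | rfl | rfl | rfl | rfl | rfl | rfl <;>
    simp [unitVec_apply_of_ne hvi, unitVec_apply_of_ne hvj, unitVec_apply_of_ne hvk]

/-- `i`-coordinates of marked-code points are `x i` or `x i + 1` (`i ∉ {j, k}`). [folklore] -/
theorem apply_i_of_mem_pairCodeM (hij : i ≠ j) (hki : k ≠ i) {p : Site d L} (hp : p ∈ pairCodeM x i j k) :
    p i = x i ∨ p i = x i + 1 := by
  simp only [pairCodeM, pairCode, mem_insert, mem_singleton] at hp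
  rcases hp with rfl | rfl | rfl | rfl | rfl | rfl | rfl <;>
    simp [unitVec_apply_of_ne hij, unitVec_apply_of_ne hki.symm]

/-- `j`-coordinates of marked-code points are `x j` or `x j + 1` (`j ∉ {i, k}`). [folklore] -/
theorem apply_j_of_mem_pairCodeM (hij : i ≠ j) (hkj : k ≠ j) {p : Site d L} (hp : p ∈ pairCodeM x i j k) :
    p j = x j ∨ p j = x j + 1 := by
  simp only [pairCodeM, pairCode, mem_insert, mem_singleton] at hp
  rcases hp with rfl | rfl | rfl | rfl | rfl | rfl | rfl <;>
    simp [unitVec_apply_of_ne hij.symm, unitVec_apply_of_ne hkj.symm]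

/-- In the column `p i = x i + 1` the `k`-coordinates are `x k` or `x k + 1` (`1 ≠ 0`). [folklore] -/
theorem apply_k_of_mem_pairCodeM_of_col_i (hij : i ≠ j) (hki : k ≠ i) (h1 : (1 : ZMod L) ≠ 0) {p : Site d L}
    (hp : p ∈ pairCodeM x i j k) (hpi : p i = x i + 1) : p k = x k ∨ p k = x k + 1 := by
  simp only [pairCodeM, pairCode, mem_insert, mem_singleton] at hp
  rcases hp with rfl | rfl | rfl | rfl | rfl | rfl | rfl
  · simp only [Pi.sub_apply, unitVec_apply_of_ne hki.symm, sub_zero] at hpi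
    exact absurd (left_eq_add.1 hpi) h1
  · exact absurd (left_eq_add.1 hpi) h1
  · left; simp [unitVec_apply_of_ne hki]
  · simp only [Pi.add_apply, unitVec_apply_of_ne hij, add_zero] at hpi
    exact absurd (left_eq_add.1 hpi) h1
  · simp only [Pi.add_apply, unitVec_apply_of_ne hki.symm, add_zero] at hpi
    exact absurd (left_eq_add.1 hpi) h1
  · right; simp [unitVec_apply_of_ne hki]
  · simp only [Pi.add_apply, unitVec_apply_of_ne hki.symm, unitVec_apply_of_ne hij, add_zero] at hpi
    exact absurd (left_eq_add.1 hpi) h1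

/-- In the column `p j = x j + 1` the `k`-coordinates are `x k` or `x k + 1` (`1 ≠ 0`). [folklore] -/
theorem apply_k_of_mem_pairCodeM_of_col_j (hij : i ≠ j) (hkj : k ≠ j) (h1 : (1 : ZMod L) ≠ 0) {p : Site d L}
    (hp : p ∈ pairCodeM x i j k) (hpj : p j = x j + 1) : p k = x k ∨ p k = x k + 1 := by
  simp only [pairCodeM, pairCode, mem_insert, mem_singleton] at hp
  rcases hp with rfl | rfl | rfl | rfl | rfl | rfl | rfl
  · simp only [Pi.sub_apply, unitVec_apply_of_ne hkj.symm, sub_zero] at hpj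
    exact absurd (left_eq_add.1 hpj) h1
  · exact absurd (left_eq_add.1 hpj) h1
  · simp only [Pi.add_apply, unitVec_apply_of_ne hij.symm, add_zero] at hpj
    exact absurd (left_eq_add.1 hpj) h1
  · left; simp [unitVec_apply_of_ne hkj]
  · simp only [Pi.add_apply, unitVec_apply_of_ne hkj.symm, add_zero] at hpj
    exact absurd (left_eq_add.1 hpj) h1
  · simp only [Pi.add_apply, unitVec_apply_of_ne hkj.symm, unitVec_apply_of_ne hij.symm, add_zero] at hpj
    exact absurd (left_eq_add.1 hpj) h1
  · right; simp [unitVec_apply_of_ne hkj]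

/-- The non-constant directions of the marked code are exactly `i, j, k` (`1 ≠ 0`). [folklore] -/
theorem exists_apply_ne_iff_pairCodeM (hij : i ≠ j) (hki : k ≠ i) (hkj : k ≠ j) (h1 : (1 : ZMod L) ≠ 0) (v : Fin d) :
    (∃ p ∈ pairCodeM x i j k, ∃ q ∈ pairCodeM x i j k, p v ≠ q v) ↔ (v = i ∨ v = j ∨ v = k) := by
  constructor
  · rintro ⟨p, hp, q, hq, hpq⟩
    by_contra hv
    simp only [not_or] at hv
    exact hpq ((apply_eq_of_mem_pairCodeM hp hv.1 hv.2.1 hv.2.2).trans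
      (apply_eq_of_mem_pairCodeM hq hv.1 hv.2.1 hv.2.2).symm)
  · have hmem : ∀ w : Fin d, x + unitVec w ∈ pairCodeM x i j k → ∃ p ∈ pairCodeM x i j k, ∃ q ∈ pairCodeM x i j k,
        p w ≠ q w := fun w hw =>
      ⟨x + unitVec w, hw, x, by simp [pairCodeM, pairCode],
        fun h => h1 (add_eq_left.1 (by simpa only [Pi.add_apply, unitVec_apply_self] using h))⟩
    rintro (rfl | rfl | rfl) <;> exact hmem _ (by simp [pairCodeM, pairCode])

/-- `k` is the only direction in which the marked code shows THREE distinct coordinate values (`1, 2 ≠ 0`).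
[folklore] -/
theorem exists_three_iff_pairCodeM (hij : i ≠ j) (hki : k ≠ i) (hkj : k ≠ j) (h1 : (1 : ZMod L) ≠ 0)
    (h2 : (2 : ZMod L) ≠ 0) (v : Fin d) :
    (∃ p ∈ pairCodeM x i j k, ∃ q ∈ pairCodeM x i j k, ∃ s ∈ pairCodeM x i j k, p v ≠ q v ∧ p v ≠ s v ∧ q v ≠ s v) ↔
      v = k := by
  constructor
  · rintro ⟨p, hp, q, hq, s, hs, hpq, hps, hqs⟩
    by_contra hvk
    by_cases hvi : v = i
    · subst hvi
      rcases apply_i_of_mem_pairCodeM hij hki hp with hp' | hp' <;>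
        rcases apply_i_of_mem_pairCodeM hij hki hq with hq' | hq' <;>
          rcases apply_i_of_mem_pairCodeM hij hki hs with hs' | hs'
      all_goals first
        | exact hpq (hp'.trans hq'.symm) | exact hps (hp'.trans hs'.symm) | exact hqs (hq'.trans hs'.symm)
    by_cases hvj : v = j
    · subst hvj
      rcases apply_j_of_mem_pairCodeM hij hkj hp with hp' | hp' <;>
        rcases apply_j_of_mem_pairCodeM hij hkj hq with hq' | hq' <;>
          rcases apply_j_of_mem_pairCodeM hij hkj hs with hs' | hs'
      all_goals first
        | exact hpq (hp'.trans hq'.symm) | exact hps (hp'.trans hs'.symm) | exact hqs (hq'.trans hs'.symm)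
    · exact hpq ((apply_eq_of_mem_pairCodeM hp hvi hvj hvk).trans (apply_eq_of_mem_pairCodeM hq hvi hvj hvk).symm)
  · rintro rfl
    refine ⟨x - unitVec v, by simp [pairCodeM], x, by simp [pairCodeM, pairCode], x + unitVec v,
      by simp [pairCodeM, pairCode], ?_, ?_, ?_⟩
    · simp only [Pi.sub_apply, unitVec_apply_self]
      intro h
      exact h1 (by simpa using h)
    · simp only [Pi.sub_apply, Pi.add_apply, unitVec_apply_self]
      intro h
      have : (2 : ZMod L) = 0 := by linear_combination -h
      exact h2 this
    · simp only [Pi.add_apply, unitVec_apply_self]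
      exact fun h => h1 (left_eq_add.1 h)

end Coordinates

/-- **The marked code determines the pair up to orientation** (`3 ≤ L`): equal marked codes have the same base point,
the same transverse direction and the same unordered pair of plaquette directions. [folklore] -/
theorem pairCodeM_decode (hL : 3 ≤ L) {x x' : Site d L} {i j k i' j' k' : Fin d}
    (hij : i ≠ j) (hki : k ≠ i) (hkj : k ≠ j) (hij' : i' ≠ j') (hki' : k' ≠ i') (hkj' : k' ≠ j')
    (h : pairCodeM x i j k = pairCodeM x' i' j' k') :
    x = x' ∧ k = k' ∧ ((i = i' ∧ j = j') ∨ (i = j' ∧ j = i')) := by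
  have h1 := one_ne_zero_of_three_le hL
  have h2 := two_ne_zero_of_three_le hL
  -- `k = k'`
  have hk : k' = k := by
    have := (exists_three_iff_pairCodeM (x := x') hij' hki' hkj' h1 h2 k').2 rfl
    rw [← h] at this
    exact (exists_three_iff_pairCodeM hij hki hkj h1 h2 k').1 this
  subst hk
  -- `{i', j'} ⊆ {i, j}`
  have hdir : ∀ w, (w = i' ∨ w = j' ∨ w = k') → (w = i ∨ w = j ∨ w = k') := fun w hw => by
    have := (exists_apply_ne_iff_pairCodeM (x := x') hij' hki' hkj' h1 w).2 hw
    rw [← h] at this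
    exact (exists_apply_ne_iff_pairCodeM hij hki hkj h1 w).1 this
  have hi' : i' = i ∨ i' = j := by
    rcases hdir i' (Or.inl rfl) with h' | h' | h'
    · exact Or.inl h'
    · exact Or.inr h'
    · exact absurd h'.symm hki'
  have hj' : j' = i ∨ j' = j := by
    rcases hdir j' (Or.inr (Or.inl rfl)) with h' | h' | h'
    · exact Or.inl h'
    · exact Or.inr h'
    · exact absurd h'.symm hkj'
  have hor : (i = i' ∧ j = j') ∨ (i = j' ∧ j = i') := by
    rcases hi' with rfl | rfl <;> rcases hj' with h' | h'
    · exact absurd h'.symm hij'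
    · exact Or.inl ⟨rfl, h'.symm⟩
    · exact Or.inr ⟨h'.symm, rfl⟩
    · exact absurd h'.symm hij'
  -- coordinates of `x`
  have hxS : x' ∈ pairCodeM x i j k' := by rw [h]; simp [pairCodeM, pairCode]
  have hxS' : x ∈ pairCodeM x' i' j' k' := by rw [← h]; simp [pairCodeM, pairCode]
  -- the `i`- and `j`-coordinate ranges of the primed code, in the unprimed directions
  have hPi : ∀ p ∈ pairCodeM x' i' j' k', p i = x' i ∨ p i = x' i + 1 := by
    intro p hp
    rcases hor with ⟨rfl, rfl⟩ | ⟨rfl, rfl⟩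
    · exact apply_i_of_mem_pairCodeM hij' hki' hp
    · exact apply_j_of_mem_pairCodeM hij' hkj' hp
  have hPj : ∀ p ∈ pairCodeM x' i' j' k', p j = x' j ∨ p j = x' j + 1 := by
    intro p hp
    rcases hor with ⟨rfl, rfl⟩ | ⟨rfl, rfl⟩
    · exact apply_j_of_mem_pairCodeM hij' hkj' hp
    · exact apply_i_of_mem_pairCodeM hij' hki' hp
  have hxi : x' i = x i := eq_of_mem_pair_of_mem_pair h2 (apply_i_of_mem_pairCodeM hij hki hxS) (hPi x hxS')
  have hxj : x' j = x j := eq_of_mem_pair_of_mem_pair h2 (apply_j_of_mem_pairCodeM hij hkj hxS) (hPj x hxS')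
  have hxk : x' k' = x k' := by
    have hp : x' + unitVec i ∈ pairCodeM x i j k' := by
      rw [h]; rcases hor with ⟨rfl, -⟩ | ⟨rfl, -⟩ <;> simp [pairCodeM, pairCode]
    have hq : x + unitVec i ∈ pairCodeM x' i' j' k' := by rw [← h]; simp [pairCodeM, pairCode]
    have hp' := apply_k_of_mem_pairCodeM_of_col_i hij hki h1 hp (by simp [unitVec_apply_self, hxi])
    have hq' : (x + unitVec i : Site d L) k' = x' k' ∨ (x + unitVec i : Site d L) k' = x' k' + 1 := by
      rcases hor with ⟨rfl, rfl⟩ | ⟨rfl, rfl⟩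
      · exact apply_k_of_mem_pairCodeM_of_col_i hij' hki' h1 hq (by simp [unitVec_apply_self, hxi])
      · exact apply_k_of_mem_pairCodeM_of_col_j hij' hkj' h1 hq (by simp [unitVec_apply_self, hxi])
    simp only [Pi.add_apply, unitVec_apply_of_ne hki, add_zero] at hp' hq'
    exact eq_of_mem_pair_of_mem_pair h2 hp' hq'
  refine ⟨funext fun v => ?_, rfl, hor⟩
  by_cases hvi : v = i
  · subst hvi; exact hxi.symm
  by_cases hvj : v = j
  · subst hvj; exact hxj.symm
  by_cases hvk : v = k'
  · subst hvk; exact hxk.symm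
  · exact (apply_eq_of_mem_pairCodeM hxS hvi hvj hvk).symm

/-! ### Range of the marked code -/

/-- Every coordinate of a marked-code point differs from that of `x` by `−1, 0` or `1`. [folklore] -/
theorem exists_int_of_mem_pairCodeM {x : Site d L} {i j k : Fin d} (hki : k ≠ i) (hkj : k ≠ j) {p : Site d L}
    (hp : p ∈ pairCodeM x i j k) (v : Fin d) : ∃ a : ℤ, a.natAbs ≤ 1 ∧ p v = x v + (a : ZMod L) := by
  simp only [pairCodeM, mem_insert] at hp
  rcases hp with rfl | hp
  · by_cases h : v = k
    · subst h; exact ⟨-1, by norm_num, by simp [sub_eq_add_neg]⟩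
    · exact ⟨0, by norm_num, by simp [unitVec_apply_of_ne h]⟩
  · rcases apply_mem_pairCode hki hkj hp v with h | h
    · exact ⟨0, by norm_num, by simp [h]⟩
    · exact ⟨1, by norm_num, by simp [h]⟩

/-- The marked code has periodic sup-diameter `≤ 2`. [folklore] -/
theorem polymerDiam_pairCodeM_le {x : Site d L} {i j k : Fin d} (hki : k ≠ i) (hkj : k ≠ j) :
    polymerDiam (pairCodeM x i j k) ≤ 2 := by
  refine Finset.sup_le fun p hp => Finset.sup_le fun q hq => Finset.sup_le fun v _ => ?_
  obtain ⟨a, ha, hpa⟩ := exists_int_of_mem_pairCodeM hki hkj hp v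
  obtain ⟨b, hb, hqb⟩ := exists_int_of_mem_pairCodeM hki hkj hq v
  show ((p - q) v).valMinAbs.natAbs ≤ 2
  rw [Pi.sub_apply, hpa, hqb, show x v + (a : ZMod L) - (x v + (b : ZMod L)) = ((a - b : ℤ) : ZMod L) by
    push_cast; ring]
  exact (natAbs_valMinAbs_intCast_le L (a - b)).trans (by omega)

end Summit.Ventures.YMGap.RobustBall

end
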